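import Literature.Geometry.Lorentzian.CoordConstraintAdjoint
import Literature.Geometry.Lorentzian.CoordFlatBackground
import Literature.Geometry.Lorentzian.CoordLaplacianPerturbation
import Literature.Geometry.Lorentzian.CoordCurvatureNormSq
import HarnessLib

/-!
# The KIDs of the flat background `(δ, 0)`: static potentials `1, x_l` and Killing fields `e_l, Y_l`

(trunk G08 = T-LORENTZ; family `gr`; namespace `Literature.Geometry.Lorentzian.MetricCoord`.)

In the Corvino–Schoen / Chruściel–Delay gluing scheme the obstruction (cokernel of the linearised
constraint map `DΦ`) is the space of KIDs `(N, X)`: solutions of the adjoint equations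
`DΦ*(N, X) = 0` (`CoordConstraintAdjoint.lean`: `adjHamG`, `adjHamK`, `adjMomGS`, `adjMomKS`, the
Green identity `IsMetricOn.linConstraint_pairing_eq_sym` and its KID corollary
`linConstraint_pairing_eq_divAt_of_kid_sym`). Mao–Oh–Tao (arXiv:2308.13031, §2.2, after Lemma 2.2)
record the flat case: "`1, x_1, x_2, x_3` span the kernel of the formal `L²`-adjoint of the double
divergence operator `h ↦ ∂_i∂_j h^{ij}` (resp. `e_1, …, Y_3` span the kernel of the formal
`L²`-adjoint of the symmetric divergence operator `π ↦ ∂_i π^{ij}`)", which is the source of the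
ten conserved charges `(E, P, C, J)` of Lemma 2.7 (`LinearChargeConservation.lean`). This file
proves it in the `MetricCoord` calculus:

* `adjHamK_zeroK`, `adjHamG_zeroK`, `adjMomGS_zeroK` (any components `G`) — at `K = 0` the KID
  equations decouple into `DS*_G(N) = 0` and `DM*ˢ_κ(X) = 0`;
* `adjScalAt_innerSL` — `DS*_δ(N) = Hess N − (ΔN) δ`, so every `N` with `D²N(x) = 0` is a static KID
  of `δ` at `x` (`adjScalAt_innerSL_eq_zero_of_fderiv_fderiv_eq_zero`; the constants and the
  coordinate functions `⟪a, ·⟫`: `adjScalAt_innerSL_const`, `adjScalAt_innerSL_inner`);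
* `adjMomKS_innerSL` — `DM*ˢ_κ(X) = −sym⟪DX·,·⟫ + (tr DX) δ`, so every `X` with skew differential
  is a KID (`adjMomKS_innerSL_eq_zero_of_skew`, `traceCLM_eq_zero_of_skew`; translations
  `adjMomKS_innerSL_const`, and rotations `Y_l`, whose differential is skew);
* `flatKID_pairing_eq_divAt` — **for such `(N, X)` the pairing `N · DH_{(δ,0)}(γ,κ) + DM_{(δ,0)}(γ,κ)(X)`
  is an exact divergence** (the Green identity at the flat background), the pointwise identity
  behind Mao–Oh–Tao's Lemma 2.7.

Everything is proved; no definitions, no named facts.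

## References

* Y. Mao, S.-J. Oh, T. Tao, arXiv:2308.13031 (2023), §2.2 (after Lemma 2.2) and Lemma 2.7
  (key `MaoOhTao2023`).
* P. T. Chruściel, E. Delay, Mém. SMF 94 (2003), §2 (key `ChruscielDelay2003`).
* V. Moncrief, *Spacetime symmetries and linearization stability of the Einstein equations. I*,
  J. Math. Phys. 16 (1975), 493–498.
-/

noncomputable section

set_option maxSynthPendingDepth 3

open scoped RealInnerProductSpace ContDiff

namespace Literature.Geometry.Lorentzian

namespace MetricCoord

section ZeroK

variable {E : Type*} [NormedAddCommGroup E] [NormedSpace ℝ E] [FiniteDimensional ℝ E]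
  (G : E → E →L[ℝ] E →L[ℝ] ℝ) (x : E)

omit [FiniteDimensional ℝ E] in
/-- The metric trace of the zero form vanishes. [folklore] -/
theorem mtrAt_zero : mtrAt G x 0 = 0 := by
  simp [mtrAt]

omit [FiniteDimensional ℝ E] in
/-- **At `K = 0` the `κ`-row of `DH*` vanishes**: `DH*_κ(N) = −2N K + 2N (tr K) G = 0`. [cite: ChruscielDelay2003, §2] -/
theorem adjHamK_zeroK (N : E → ℝ) : adjHamK G (fun _ ↦ 0) N x = 0 := by
  simp [adjHamK, mtrAt_zero]

/-- **At `K = 0` the `γ`-row of `DH*` is `DS*`**: `DH*_γ(N) = DS*_G(N)`. [cite: ChruscielDelay2003, §2] -/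
theorem adjHamG_zeroK (N : E → ℝ) : adjHamG G (fun _ ↦ 0) N x = adjScalAt G N x := by
  simp [adjHamG]

omit [FiniteDimensional ℝ E] in
/-- The covariant differential of the zero field of bilinear forms vanishes. [folklore] -/
theorem cov₂At_zero_field : cov₂At G (fun _ : E ↦ (0 : E →L[ℝ] E →L[ℝ] ℝ)) x = 0 := by
  ext W Y Z
  simp [cov₂At_apply]

/-- The divergence of the zero vector field vanishes. [folklore] -/
theorem divAt_zero_field : divAt G (fun _ : E ↦ (0 : E)) x = 0 := by
  rw [divAt_eq, covDAt]
  simp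

/-- **At `K = 0` the symmetrised `γ`-row of `DM*` vanishes** for every vector field `X` (each of its terms carries a
factor `K`). Hence at `K = 0` the KID equations decouple into `DS*_G(N) = 0` and `DM*ˢ_κ(X) = 0`.
[cite: ChruscielDelay2003, §2] -/
theorem adjMomGS_zeroK (X : E → E) : adjMomGS G (fun _ ↦ 0) X x = 0 := by
  rw [adjMomGS, cov₂At_zero_field]
  have h0 : (fun y : E ↦ sharpAt G y ((0 : E →L[ℝ] E →L[ℝ] ℝ) (X y))) = fun _ ↦ (0 : E) := by
    funext y; simp
  rw [h0, divAt_zero_field]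
  ext v w
  simp [symAt_apply]

end ZeroK

/-! ### The flat background: static potentials and Killing fields are KIDs of `(δ, 0)` -/

section Flat

variable {E : Type*} [NormedAddCommGroup E] [InnerProductSpace ℝ E] [FiniteDimensional ℝ E]

/-- **`DS*_δ(N) = Hess N − (Δ N) δ`** at the flat background (`Ric_δ = 0`). [cite: ChruscielDelay2003, §2] -/
theorem adjScalAt_innerSL (N : E → ℝ) (x : E) :
    adjScalAt (fun _ : E ↦ (innerSL ℝ : E →L[ℝ] E →L[ℝ] ℝ)) N x =
      -(lapAt (fun _ : E ↦ (innerSL ℝ : E →L[ℝ] E →L[ℝ] ℝ)) N x) • (innerSL ℝ : E →L[ℝ] E →L[ℝ] ℝ)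
        + hessAt (fun _ : E ↦ (innerSL ℝ : E →L[ℝ] E →L[ℝ] ℝ)) N x := by
  rw [adjScalAt, ricAt_innerSL, smul_zero, sub_zero]

/-- **Static KIDs of the flat background**: if `D²N(x) = 0` then `DS*_δ(N)(x) = 0`. [cite: MaoOhTao2023, §2.2] -/
theorem adjScalAt_innerSL_eq_zero_of_fderiv_fderiv_eq_zero {N : E → ℝ} {x : E}
    (h2 : fderiv ℝ (fderiv ℝ N) x = 0) : adjScalAt (fun _ : E ↦ (innerSL ℝ : E →L[ℝ] E →L[ℝ] ℝ)) N x = 0 := by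
  have hH : hessAt (fun _ : E ↦ (innerSL ℝ : E →L[ℝ] E →L[ℝ] ℝ)) N x = 0 := by
    ext v w
    simp [hessAt_apply, chrAt_innerSL, h2]
  have hL : lapAt (fun _ : E ↦ (innerSL ℝ : E →L[ℝ] E →L[ℝ] ℝ)) N x = 0 := by
    rw [lapAt, hH]
    simp [mtrAt]
  rw [adjScalAt_innerSL, hH, hL]
  simp

/-- The constants are static KIDs of `δ` (the energy `E`). [cite: MaoOhTao2023, §2.2] -/
theorem adjScalAt_innerSL_const (c : ℝ) (x : E) :
    adjScalAt (fun _ : E ↦ (innerSL ℝ : E →L[ℝ] E →L[ℝ] ℝ)) (fun _ ↦ c) x = 0 :=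
  adjScalAt_innerSL_eq_zero_of_fderiv_fderiv_eq_zero (by
    rw [show fderiv ℝ (fun _ : E ↦ c) = fun _ ↦ 0 from funext fun y ↦ fderiv_const_apply c]
    exact fderiv_const_apply _)

/-- The linear functions `⟪a, ·⟫` — in particular the coordinates `x_l` — are static KIDs of `δ` (the centre of mass
`C_l`). [cite: MaoOhTao2023, §2.2] -/
theorem adjScalAt_innerSL_inner (a x : E) :
    adjScalAt (fun _ : E ↦ (innerSL ℝ : E →L[ℝ] E →L[ℝ] ℝ)) (fun y ↦ ⟪a, y⟫) x = 0 :=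
  adjScalAt_innerSL_eq_zero_of_fderiv_fderiv_eq_zero (by
    rw [show fderiv ℝ (fun y : E ↦ ⟪a, y⟫) = fun _ ↦ (innerSL ℝ a : E →L[ℝ] ℝ) from
      funext fun y ↦ (innerSL ℝ a).fderiv]
    exact fderiv_const_apply _)

/-- **`DM*ˢ_κ(X) = −sym⟪DX(x)·, ·⟫ + (tr DX(x)) δ`** at the flat background (`Γ_δ = 0`): it depends only on the
differential of `X`. [cite: ChruscielDelay2003, §2] -/
theorem adjMomKS_innerSL (X : E → E) (x : E) :
    adjMomKS (fun _ : E ↦ (innerSL ℝ : E →L[ℝ] E →L[ℝ] ℝ)) X x =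
      -symAt ((innerSL ℝ : E →L[ℝ] E →L[ℝ] ℝ).comp (fderiv ℝ X x))
      + (traceCLM E (fderiv ℝ X x)) • (innerSL ℝ : E →L[ℝ] E →L[ℝ] ℝ) := by
  rw [adjMomKS, divAt_eq, covDAt, chrAt_innerSL, zero_apply, add_zero]

/-- The trace of a skew-adjoint endomorphism of a Euclidean space vanishes. [folklore] -/
theorem traceCLM_eq_zero_of_skew {A : E →L[ℝ] E} (hA : ∀ v w : E, ⟪A v, w⟫ = -⟪v, A w⟫) :
    traceCLM E A = 0 := by
  classical
  set b := stdOrthonormalBasis ℝ E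
  have hb : ∀ i j, ((fun _ : E ↦ (innerSL ℝ : E →L[ℝ] E →L[ℝ] ℝ))) (0 : E) (b.toBasis i) (b.toBasis j) =
      if i = j then 1 else 0 := fun i j ↦ by
    rw [OrthonormalBasis.coe_toBasis]
    exact (orthonormal_iff_ite.1 b.orthonormal) i j
  rw [traceCLM_eq_sum_of_orthonormal (G := (fun _ : E ↦ (innerSL ℝ : E →L[ℝ] E →L[ℝ] ℝ))) (x := (0 : E)) b.toBasis hb]
  simp only [OrthonormalBasis.coe_toBasis]
  refine Finset.sum_eq_zero fun i _ ↦ ?_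
  show ⟪A (b i), b i⟫ = 0
  have h1 := hA (b i) (b i)
  rw [real_inner_comm (A (b i)) (b i)] at h1
  linarith

/-- **Vector fields with skew differential are KIDs of `(δ, 0)`**: `DM*ˢ_κ(X)(x) = 0` whenever
`⟪DX(x) v, w⟫ = −⟪v, DX(x) w⟫` — the translations `e_l` (`DX = 0`, the momenta `P_l`) and the rotations `Y_l = e_l × x`
(`DX` skew, the angular momenta `J_l`). [cite: MaoOhTao2023, §2.2] -/
theorem adjMomKS_innerSL_eq_zero_of_skew {X : E → E} {x : E}
    (hX : ∀ v w : E, ⟪fderiv ℝ X x v, w⟫ = -⟪v, fderiv ℝ X x w⟫) :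
    adjMomKS (fun _ : E ↦ (innerSL ℝ : E →L[ℝ] E →L[ℝ] ℝ)) X x = 0 := by
  rw [adjMomKS_innerSL, traceCLM_eq_zero_of_skew hX, zero_smul, add_zero, neg_eq_zero]
  ext v w
  rw [symAt_apply]
  simp only [ContinuousLinearMap.comp_apply, innerSL_apply_apply, zero_apply]
  rw [hX w v, real_inner_comm (fderiv ℝ X x v) w]
  ring

/-- The translations (constant fields) are KIDs of `(δ, 0)`. [cite: MaoOhTao2023, §2.2] -/
theorem adjMomKS_innerSL_const (c x : E) : adjMomKS (fun _ : E ↦ (innerSL ℝ : E →L[ℝ] E →L[ℝ] ℝ)) (fun _ ↦ c) x = 0 :=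
  adjMomKS_innerSL_eq_zero_of_skew (by simp [fderiv_const_apply])


/-- **The flat KIDs make the linearised constraints an exact divergence** (the Green identity of
`CoordConstraintAdjoint.lean` at `(δ, 0)`): for smooth symmetric variations `(γ, κ)`, a smooth `N` with `D²N(x) = 0`
(e.g. `1`, `x_l`) and a smooth `X` with skew `DX(x)` (e.g. `e_l`, `Y_l`),
`N(x) · DH_{(δ,0)}(γ,κ)(x) + DM_{(δ,0)}(γ,κ)(x)(X(x)) = div_δ (B_N + C_X)(x)`. Integrated over a shell against the radial
cut-off this is Mao–Oh–Tao's Lemma 2.7 (`LinearChargeConservation.lean`, where the fluxes are explicit).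
[cite: MaoOhTao2023, Lemma 2.7] -/
theorem flatKID_pairing_eq_divAt [CompleteSpace E] {ι : Type*} [Fintype ι] (b : Module.Basis ι ℝ E)
    {γ κ : E → E →L[ℝ] E →L[ℝ] ℝ} (hγ : ContDiff ℝ ∞ γ) (hγs : ∀ y v w, γ y v w = γ y w v)
    (hκ : ContDiff ℝ ∞ κ) (hκs : ∀ y v w, κ y v w = κ y w v)
    {N : E → ℝ} (hN : ContDiff ℝ ∞ N) {X : E → E} (hX : ContDiff ℝ ∞ X) (x : E)
    (hN2 : fderiv ℝ (fderiv ℝ N) x = 0)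
    (hXskew : ∀ v w : E, ⟪fderiv ℝ X x v, w⟫ = -⟪v, fderiv ℝ X x w⟫) :
    N x * linHamFn b (fun _ : E ↦ (innerSL ℝ : E →L[ℝ] E →L[ℝ] ℝ)) (fun _ ↦ 0) γ κ x
        + linMomFn b (fun _ : E ↦ (innerSL ℝ : E →L[ℝ] E →L[ℝ] ℝ)) (fun _ ↦ 0) γ κ x (X x) =
      divAt (fun _ : E ↦ (innerSL ℝ : E →L[ℝ] E →L[ℝ] ℝ)) (greenVec b (fun _ : E ↦ (innerSL ℝ : E →L[ℝ] E →L[ℝ] ℝ)) N γ) x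
        + divAt (fun _ : E ↦ (innerSL ℝ : E →L[ℝ] E →L[ℝ] ℝ))
          (momGreenVec (fun _ : E ↦ (innerSL ℝ : E →L[ℝ] E →L[ℝ] ℝ)) (fun _ ↦ 0) γ κ X) x := by
  have hG : IsMetricOn (fun _ : E ↦ (innerSL ℝ : E →L[ℝ] E →L[ℝ] ℝ)) Set.univ :=
    isMetricOn_const_inner (δ := (innerSL ℝ : E →L[ℝ] E →L[ℝ] ℝ)) (fun _ _ ↦ rfl) isOpen_univ
  refine hG.linConstraint_pairing_eq_divAt_of_kid_sym b (Set.mem_univ x) contDiffOn_const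
    (fun _ _ _ _ ↦ rfl) hγ.contDiffOn (fun y _ ↦ hγs y) hκ.contDiffOn (fun y _ ↦ hκs y)
    hN.contDiffOn hX.contDiffOn ?_ ?_
  · rw [adjHamG_zeroK, adjMomGS_zeroK, add_zero]
    exact adjScalAt_innerSL_eq_zero_of_fderiv_fderiv_eq_zero hN2
  · rw [adjHamK_zeroK, zero_add]
    exact adjMomKS_innerSL_eq_zero_of_skew hXskew

end Flat

end MetricCoord

end Literature.Geometry.Lorentzian

end
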